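import Summits.BirchSwinnertonDyer.BirchSwinnertonDyer.Theses.ThetaPartnerAtTwo
import Summits.BirchSwinnertonDyer.BirchSwinnertonDyer.Theorems.ThetaPartnerAtTwoSignedTransportAtTwoBridgeCongruence
import Summits.BirchSwinnertonDyer.BirchSwinnertonDyer.Theorems.ThetaPartnerAtTwoSignedTransportAtTwoMazurTateLimit
import HarnessLib

/-!
# Crux `SignedTransportAtTwo` (stmt-BirchSwinnertonDyer-20333, route `ThetaPartnerAtTwo`): the analytic binder AT THE
# MAZUR–TATE LEVEL — layer-wise congruences modulo `2` of the Néron-normalised NON-PRIMITIVE Mazur–Tate elements of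
# `W` and of its CM partner `A` imply the `Λ`-level congruence binder V2cong, hence the crux BY NAME
# (lead prover bsd-wall-tp2-p1 g2; `--supports stmt-BirchSwinnertonDyer-20333`; closes nothing)

HONEST FRAMING. THEOREMS ONLY; every research input is an explicit hypothesis spelled inline; nothing about any curve is
asserted; BSD is not proved by any of this. Fifth composition of the line `bridge`.

WHY THIS SHAPE. What a congruence `W[2] ≅ A[2]` gives on the analytic side is, in print (Vatsal, Duke Math. J. 98 (1999)
Thm. (1.10); Greenberg–Vatsal 2000 §3), a congruence of SPECIAL VALUES `L(f_W, χ, 1)/Ω` and `L(f_A, χ, 1)/Ω` for all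
finite-order characters `χ` of the cyclotomic tower — equivalently of the Mazur–Tate elements `θ_n` layer by layer —
and it is `θ_n` that the kit numerics of this route read (ENGINE-2, `λ(θ_n)`-vectors; KIT-RESULT-TP2-CM-ANCHORS-v1).
The binder `hV2mt` (= registered stub `stub_V2mt` of line `bridge` v5) says exactly that, READ AT `2`, for the
Néron-normalised, `S₀`-depleted, integralised elements `Θ_n^W = 2^m ϖ·θ_n(f_W)·∏_{S₀}𝒫(W)`,
`Θ_n^A = 2^{m'} ϖ_A·θ_n(f_A)·∏_{S₀}𝒫(A)` (`2^m ϖ L♭_W`, `2^{m'} ϖ_A L♭_A ∈ Λ` being the frame's integral multiples):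
for some `u ∈ ℤ₂ˣ` and every even layer `n`, `2^{m'}·Θ_n^W − u·2^m·Θ_n^A ∈ (2^{m+m'+1}, ω_n)Λ`. From it, Pollack's
interpolation `θ_n ≡ (−1)^{n/2+1} ω_n^- L♭ (mod ω_n)` on both sides (the frame's `IsPollackPair` data at `2`) and
the `Λ`-algebra of `…MazurTateLimit.lean` (`omega_mul_mem_of_layerCongr`: clear denominators against `ω_n`;
`C_pow_dvd_of_forall_even`: `ω_n^- ≡ T^{deg}`, `ω_n ≡ T^{2ⁿ}` mod `2` and `deg ω_n^+ → ∞`) give the `Λ`-level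
congruence binder V2cong of `…BridgeCongruence.lean` (`v2cong_of_v2mt`), and the landed compositions give the crux BY
NAME (`signedTransportAtTwo_of_gvBinders_mazurTate`). V2mt is Vatsal's theorem READ AT `2` for non-primitive,
Néron-normalised elements along `W[2] ≅ A[2]` with `A` CM — unpublished at `p = 2` (multiplicity one mod `2`,
Néron-vs-canonical period at `2`); a research hypothesis here, not a fact. No sorry; standard axioms.

References: [Vatsal1999] Thm. (1.10); [GreenbergVatsal2000] §3, Thm. (1.6); [Pollack2003] Prop. 6.18;
[EmertonPollackWeston2006] Thm. 1; [BDKim2009] Cor. 2.13; [Kobayashi2003] Conjecture (p. 2).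
-/

set_option autoImplicit false
-- D-0017: single-problem summit, so `Summit.BirchSwinnertonDyer.BirchSwinnertonDyer.…` repeats a namespace BY DESIGN.
set_option linter.dupNamespace false

noncomputable section

open scoped Classical MatrixGroups ModularForm BigOperators

open CongruenceSubgroup Polynomial WeierstrassCurve NumberField IsDedekindDomain Rat.HeightOneSpectrum
  Literature Literature.NumberTheory.EllipticCurves
  Literature.NumberTheory.EllipticCurves.ModularForms
  Literature.NumberTheory.EllipticCurves.Rank1Residual
  Literature.NumberTheory.EllipticCurves.Kobayashi2003 ZpExtension
  Literature.NumberTheory.EllipticCurves.GreenbergVatsal2000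
  Literature.NumberTheory.EllipticCurves.Sprung2017
  Summit.BirchSwinnertonDyer.Rank1Residual.X1.MuLambda
  Summit.BirchSwinnertonDyer.Rank1Residual.Supersingular
  Summit.BirchSwinnertonDyer.Rank1Residual.X2.EulerFactorInvariants
  Summit.BirchSwinnertonDyer.BirchSwinnertonDyer.Theorems.TwoAdicTwistConverse

namespace Summit.BirchSwinnertonDyer.BirchSwinnertonDyer.Theorems.SignedTransportAtTwo

/-! ## §1. V2mt ⇒ V2cong at `p = 2` -/

/-- **V2mt ⇒ V2cong.** Layer-wise congruences `2^{m'}·Θ_n^W − u·2^m·Θ_n^A ∈ (2^{m+m'+1}, ω_n)Λ` (every even `n`) of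
the Néron-normalised, `S₀`-depleted, integralised Mazur–Tate elements imply the congruence
`2^{m'}·G·∏𝒫(W) − u·2^m·G_A·∏𝒫(A) ∈ 2^{m+m'+1}Λ` of the corresponding `♭`-functions, using Pollack's even-layer
interpolation of `L♭` on both sides and the limit argument.
[cite: Vatsal1999, Thm. (1.10)] [cite: Pollack2003, Prop. 6.18] [cite: GreenbergVatsal2000, §3] -/
theorem v2cong_of_v2mt
    (hV2mt :
    ∀ (W : WeierstrassCurve ℚ) [W.IsElliptic] [W.IsGloballyMinimal] (A : WeierstrassCurve ℚ) [A.IsElliptic]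
      [A.IsGloballyMinimal], ¬ W.HasCM → W.analyticRank = 0 → GoodSS W 2 → W.frobeniusTrace 2 = 0 →
      A.HasCM → GoodSS A 2 → A.frobeniusTrace 2 = 0 →
    (∃ e : WeierstrassCurve.geomTorsion W (2 : ℤ) ≃+ WeierstrassCurve.geomTorsion A (2 : ℤ),
      ∀ (σ : Field.absoluteGaloisGroup ℚ) (P : WeierstrassCurve.geomTorsion W (2 : ℤ)), e (σ • P) = σ • e P) →
    ∀ (γ : Field.absoluteGaloisGroup ℚ), IsCyclotomicVariable 2 γ →
    ∀ [NeZero (W.conductorNorm ℤ)] (f : CuspForm (Gamma0 (W.conductorNorm ℤ)) 2), IsNewformOf W f →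
    ∀ (ϖ : ℚ), (ϖ : ℝ) * W.realPeriodRat = plusPeriod f →
    ∀ (Lplus Lminus : IwasawaAlgebra 2), IsPollackPair f 2 Lplus Lminus →
    ∀ [NeZero (A.conductorNorm ℤ)] (fA : CuspForm (Gamma0 (A.conductorNorm ℤ)) 2), IsNewformOf A fA →
    ∀ (ϖA : ℚ), (ϖA : ℝ) * A.realPeriodRat = plusPeriod fA →
    ∀ (LplusA LminusA : IwasawaAlgebra 2), IsPollackPair fA 2 LplusA LminusA →
    ∀ (S₀ : Finset (HeightOneSpectrum (𝓞 ℚ))), (∀ v ∈ S₀, ((2 : ℕ) : 𝓞 ℚ) ∉ v.asIdeal) →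
      (∀ v : HeightOneSpectrum (𝓞 ℚ), ¬ W.HasGoodReductionAt v → v ∈ S₀) →
      (∀ v : HeightOneSpectrum (𝓞 ℚ), ¬ A.HasGoodReductionAt v → v ∈ S₀) →
    ∀ (G : IwasawaAlgebra 2) (m : ℕ), iwasawaToPowerSeries 2 G =
        PowerSeries.C ((2 : ℚ_[2]) ^ m * (ϖ : ℚ_[2])) * iwasawaToPowerSeries 2 (kobayashiL 1 Lplus Lminus) →
    ∀ (GA : IwasawaAlgebra 2) (m' : ℕ), iwasawaToPowerSeries 2 GA =
        PowerSeries.C ((2 : ℚ_[2]) ^ m' * (ϖA : ℚ_[2])) * iwasawaToPowerSeries 2 (kobayashiL 1 LplusA LminusA) →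
    ∃ u : ℤ_[2]ˣ, ∀ n : ℕ, Even n → ∃ q r : IwasawaAlgebra 2,
      PowerSeries.C (((2 : ℤ_[2]) ^ m' : ℤ_[2]) : ℚ_[2]) *
          (PowerSeries.C ((2 : ℚ_[2]) ^ m * (ϖ : ℚ_[2])) *
            ((mazurTateElement f 2 n).map (algebraMap ℚ ℚ_[2]) : PowerSeries ℚ_[2]) *
            iwasawaToPowerSeries 2 (eulerFactorProduct W 2 S₀)) -
        PowerSeries.C (((u : ℤ_[2]) * (2 : ℤ_[2]) ^ m : ℤ_[2]) : ℚ_[2]) *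
          (PowerSeries.C ((2 : ℚ_[2]) ^ m' * (ϖA : ℚ_[2])) *
            ((mazurTateElement fA 2 n).map (algebraMap ℚ ℚ_[2]) : PowerSeries ℚ_[2]) *
            iwasawaToPowerSeries 2 (eulerFactorProduct A 2 S₀)) =
      iwasawaToPowerSeries 2
        (PowerSeries.C ((2 : ℤ_[2]) ^ (m + m' + 1)) * q + toIwasawa 2 (cyclotomicOmega 2 n) * r)) :
    ∀ (W : WeierstrassCurve ℚ) [W.IsElliptic] [W.IsGloballyMinimal] (A : WeierstrassCurve ℚ) [A.IsElliptic]
      [A.IsGloballyMinimal], ¬ W.HasCM → W.analyticRank = 0 → GoodSS W 2 → W.frobeniusTrace 2 = 0 →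
      A.HasCM → GoodSS A 2 → A.frobeniusTrace 2 = 0 →
    (∃ e : WeierstrassCurve.geomTorsion W (2 : ℤ) ≃+ WeierstrassCurve.geomTorsion A (2 : ℤ),
      ∀ (σ : Field.absoluteGaloisGroup ℚ) (P : WeierstrassCurve.geomTorsion W (2 : ℤ)), e (σ • P) = σ • e P) →
    ∀ (γ : Field.absoluteGaloisGroup ℚ), IsCyclotomicVariable 2 γ →
    ∀ [NeZero (W.conductorNorm ℤ)] (f : CuspForm (Gamma0 (W.conductorNorm ℤ)) 2), IsNewformOf W f →
    ∀ (ϖ : ℚ), (ϖ : ℝ) * W.realPeriodRat = plusPeriod f →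
    ∀ (Lplus Lminus : IwasawaAlgebra 2), IsPollackPair f 2 Lplus Lminus →
    ∀ [NeZero (A.conductorNorm ℤ)] (fA : CuspForm (Gamma0 (A.conductorNorm ℤ)) 2), IsNewformOf A fA →
    ∀ (ϖA : ℚ), (ϖA : ℝ) * A.realPeriodRat = plusPeriod fA →
    ∀ (LplusA LminusA : IwasawaAlgebra 2), IsPollackPair fA 2 LplusA LminusA →
    ∀ (S₀ : Finset (HeightOneSpectrum (𝓞 ℚ))), (∀ v ∈ S₀, ((2 : ℕ) : 𝓞 ℚ) ∉ v.asIdeal) →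
      (∀ v : HeightOneSpectrum (𝓞 ℚ), ¬ W.HasGoodReductionAt v → v ∈ S₀) →
      (∀ v : HeightOneSpectrum (𝓞 ℚ), ¬ A.HasGoodReductionAt v → v ∈ S₀) →
    ∀ (G : IwasawaAlgebra 2) (m : ℕ), iwasawaToPowerSeries 2 G =
        PowerSeries.C ((2 : ℚ_[2]) ^ m * (ϖ : ℚ_[2])) * iwasawaToPowerSeries 2 (kobayashiL 1 Lplus Lminus) →
    ∀ (GA : IwasawaAlgebra 2) (m' : ℕ), iwasawaToPowerSeries 2 GA =
        PowerSeries.C ((2 : ℚ_[2]) ^ m' * (ϖA : ℚ_[2])) * iwasawaToPowerSeries 2 (kobayashiL 1 LplusA LminusA) →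
    ∃ u : ℤ_[2]ˣ, PowerSeries.C ((2 : ℤ_[2]) ^ (m + m' + 1)) ∣
      PowerSeries.C ((2 : ℤ_[2]) ^ m') * (G * eulerFactorProduct W 2 S₀) -
        PowerSeries.C ((u : ℤ_[2]) * (2 : ℤ_[2]) ^ m) * (GA * eulerFactorProduct A 2 S₀) := by
  intro W _ _ A _ _ hcm hr hss ha hAcm hAss hAa hiso γ hcv _ f hf ϖ hϖ Lplus Lminus hPP _ fA hfA ϖA hϖA
    LplusA LminusA hPPA S₀ hS₀2 hS₀W hS₀A G m hG GA m' hGA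
  obtain ⟨u, hu⟩ := hV2mt W A hcm hr hss ha hAcm hAss hAa hiso γ hcv f hf ϖ hϖ Lplus Lminus hPP fA hfA ϖA hϖA
    LplusA LminusA hPPA S₀ hS₀2 hS₀W hS₀A G m hG GA m' hGA
  refine ⟨u, ?_⟩
  -- Kobayashi's `L^ε` for `ε = 1` is the tree's `L⁻` (= `L♭`), interpolated at the EVEN layers
  rw [show kobayashiL 1 Lplus Lminus = Lminus from if_pos rfl] at hG
  rw [show kobayashiL 1 LplusA LminusA = LminusA from if_pos rfl] at hGA
  have h2 : ((2 : ℕ) : ℤ_[2]) = (2 : ℤ_[2]) := by norm_num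
  -- the limit argument: it suffices that `ω_n^-·X ∈ (2^k, ω_n)Λ` at every even layer
  have key := C_pow_dvd_of_forall_even (p := 2) (m + m' + 1)
    (F := PowerSeries.C ((2 : ℤ_[2]) ^ m') * (G * eulerFactorProduct W 2 S₀) -
      PowerSeries.C ((u : ℤ_[2]) * (2 : ℤ_[2]) ^ m) * (GA * eulerFactorProduct A 2 S₀))
  rw [h2] at key
  refine key fun n hn => ?_
  -- Pollack's interpolation at the even layer `n` on both sides, and the layer-`n` Mazur–Tate congruence
  have hL := hPP.2.2.2 n hn
  have hLA := hPPA.2.2.2 n hn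
  obtain ⟨q, r, hqr⟩ := hu n hn
  rw [← h2] at hqr
  obtain ⟨q', r', h'⟩ := omega_mul_mem_of_layerCongr (p := 2) hL hLA hG hGA hqr
  rw [h2] at h'
  -- strip the sign `(−1)^{n/2+1}` (a unit of square `1`)
  have hsign : toIwasawa 2 ((-1) ^ (n / 2 + 1) * cyclotomicOmegaMinus 2 n) =
      (-1) ^ (n / 2 + 1) * toIwasawa 2 (cyclotomicOmegaMinus 2 n) := by
    rw [map_mul, map_pow, map_neg, map_one]
  rw [hsign] at h'
  have hsq : ((-1 : IwasawaAlgebra 2) ^ (n / 2 + 1)) * ((-1) ^ (n / 2 + 1)) = 1 := by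
    rw [← pow_add, ← two_mul, pow_mul, neg_one_sq, one_pow]
  refine ⟨(-1) ^ (n / 2 + 1) * q', (-1) ^ (n / 2 + 1) * r', ?_⟩
  linear_combination ((-1 : IwasawaAlgebra 2) ^ (n / 2 + 1)) * h' -
    (toIwasawa 2 (cyclotomicOmegaMinus 2 n) *
      (PowerSeries.C ((2 : ℤ_[2]) ^ m') * (G * eulerFactorProduct W 2 S₀) -
        PowerSeries.C ((u : ℤ_[2]) * (2 : ℤ_[2]) ^ m) * (GA * eulerFactorProduct A 2 S₀))) * hsq

/-! ## §2. The composition: Kμ2′ + Kλ2 + V2mt ⇒ the crux BY NAME -/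

/-- **The crux `SignedTransportAtTwo` BY NAME from Kμ2′ (`hmuT`), Kλ2 at `2` (`hlam2`) and the Mazur–Tate-level
analytic binder V2mt (`hV2mt`)** — `signedTransportAtTwo_of_gvBinders_congruence` (p525912) fed with
`v2cong_of_v2mt hV2mt`. Nothing asserted beyond the binders.
[cite: Vatsal1999, Thm. (1.10)] [cite: GreenbergVatsal2000, Thm. (1.4), Thm. (1.6) and Prop. (2.4)]
[cite: BDKim2009, Cor. 2.13 (pp. 185–187)] [cite: Kobayashi2003, Conjecture (p. 2)] -/
theorem signedTransportAtTwo_of_gvBinders_mazurTate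
    (hmuT :
    ∀ (W : WeierstrassCurve ℚ) [W.IsElliptic] [W.IsGloballyMinimal] (A : WeierstrassCurve ℚ) [A.IsElliptic]
      [A.IsGloballyMinimal], ¬ W.HasCM → W.analyticRank = 0 → GoodSS W 2 → W.frobeniusTrace 2 = 0 →
      A.HasCM → GoodSS A 2 → A.frobeniusTrace 2 = 0 →
    (∃ e : WeierstrassCurve.geomTorsion W (2 : ℤ) ≃+ WeierstrassCurve.geomTorsion A (2 : ℤ),
      ∀ (σ : Field.absoluteGaloisGroup ℚ) (P : WeierstrassCurve.geomTorsion W (2 : ℤ)), e (σ • P) = σ • e P) →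
    ∀ (κ : ZpExtension ℚ 2) (γ : Field.absoluteGaloisGroup ℚ), κ.IsCyclotomic → κ.IsTopGenerator γ →
    ∀ (D : SignedSelmerDualData W κ γ 1) (D' : SignedSelmerDualData A κ γ 1)
      [Module.Finite (IwasawaAlgebra 2) D.X] [Module.Finite (IwasawaAlgebra 2) D'.X],
      Module.IsTorsion (IwasawaAlgebra 2) D'.X → D'.mu = 0 →
      Module.IsTorsion (IwasawaAlgebra 2) D.X ∧ D.mu = 0)
    (hlam2 :
    ∀ (W : WeierstrassCurve ℚ) [W.IsElliptic] [W.IsGloballyMinimal] (A : WeierstrassCurve ℚ) [A.IsElliptic]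
      [A.IsGloballyMinimal], ¬ W.HasCM → W.analyticRank = 0 → GoodSS W 2 → W.frobeniusTrace 2 = 0 →
      A.HasCM → GoodSS A 2 → A.frobeniusTrace 2 = 0 →
    (∃ e : WeierstrassCurve.geomTorsion W (2 : ℤ) ≃+ WeierstrassCurve.geomTorsion A (2 : ℤ),
      ∀ (σ : Field.absoluteGaloisGroup ℚ) (P : WeierstrassCurve.geomTorsion W (2 : ℤ)), e (σ • P) = σ • e P) →
    ∀ (κ : ZpExtension ℚ 2) (γ : Field.absoluteGaloisGroup ℚ), κ.IsCyclotomic → κ.IsTopGenerator γ →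
    ∀ (S₀ : Finset (HeightOneSpectrum (𝓞 ℚ))), (∀ v ∈ S₀, ((2 : ℕ) : 𝓞 ℚ) ∉ v.asIdeal) →
      (∀ v : HeightOneSpectrum (𝓞 ℚ), ¬ W.HasGoodReductionAt v → v ∈ S₀) →
      (∀ v : HeightOneSpectrum (𝓞 ℚ), ¬ A.HasGoodReductionAt v → v ∈ S₀) →
    ∀ (D : SignedSelmerDualData W κ γ 1) (D' : SignedSelmerDualData A κ γ 1)
      [Module.Finite (IwasawaAlgebra 2) D.X] [Module.Finite (IwasawaAlgebra 2) D'.X],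
      Module.IsTorsion (IwasawaAlgebra 2) D.X → Module.IsTorsion (IwasawaAlgebra 2) D'.X → D.mu = 0 → D'.mu = 0 →
      lambdaInvariant 2 D.X +
          ∑ v ∈ S₀, 2 ^ padicValNat 2 ((Rat.HeightOneSpectrum.natGenerator v ^ 2 - 1) / 8) * dMultiplicity W 2 v =
        lambdaInvariant 2 D'.X +
          ∑ v ∈ S₀, 2 ^ padicValNat 2 ((Rat.HeightOneSpectrum.natGenerator v ^ 2 - 1) / 8) * dMultiplicity A 2 v)
    (hV2mt :
    ∀ (W : WeierstrassCurve ℚ) [W.IsElliptic] [W.IsGloballyMinimal] (A : WeierstrassCurve ℚ) [A.IsElliptic]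
      [A.IsGloballyMinimal], ¬ W.HasCM → W.analyticRank = 0 → GoodSS W 2 → W.frobeniusTrace 2 = 0 →
      A.HasCM → GoodSS A 2 → A.frobeniusTrace 2 = 0 →
    (∃ e : WeierstrassCurve.geomTorsion W (2 : ℤ) ≃+ WeierstrassCurve.geomTorsion A (2 : ℤ),
      ∀ (σ : Field.absoluteGaloisGroup ℚ) (P : WeierstrassCurve.geomTorsion W (2 : ℤ)), e (σ • P) = σ • e P) →
    ∀ (γ : Field.absoluteGaloisGroup ℚ), IsCyclotomicVariable 2 γ →
    ∀ [NeZero (W.conductorNorm ℤ)] (f : CuspForm (Gamma0 (W.conductorNorm ℤ)) 2), IsNewformOf W f →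
    ∀ (ϖ : ℚ), (ϖ : ℝ) * W.realPeriodRat = plusPeriod f →
    ∀ (Lplus Lminus : IwasawaAlgebra 2), IsPollackPair f 2 Lplus Lminus →
    ∀ [NeZero (A.conductorNorm ℤ)] (fA : CuspForm (Gamma0 (A.conductorNorm ℤ)) 2), IsNewformOf A fA →
    ∀ (ϖA : ℚ), (ϖA : ℝ) * A.realPeriodRat = plusPeriod fA →
    ∀ (LplusA LminusA : IwasawaAlgebra 2), IsPollackPair fA 2 LplusA LminusA →
    ∀ (S₀ : Finset (HeightOneSpectrum (𝓞 ℚ))), (∀ v ∈ S₀, ((2 : ℕ) : 𝓞 ℚ) ∉ v.asIdeal) →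
      (∀ v : HeightOneSpectrum (𝓞 ℚ), ¬ W.HasGoodReductionAt v → v ∈ S₀) →
      (∀ v : HeightOneSpectrum (𝓞 ℚ), ¬ A.HasGoodReductionAt v → v ∈ S₀) →
    ∀ (G : IwasawaAlgebra 2) (m : ℕ), iwasawaToPowerSeries 2 G =
        PowerSeries.C ((2 : ℚ_[2]) ^ m * (ϖ : ℚ_[2])) * iwasawaToPowerSeries 2 (kobayashiL 1 Lplus Lminus) →
    ∀ (GA : IwasawaAlgebra 2) (m' : ℕ), iwasawaToPowerSeries 2 GA =
        PowerSeries.C ((2 : ℚ_[2]) ^ m' * (ϖA : ℚ_[2])) * iwasawaToPowerSeries 2 (kobayashiL 1 LplusA LminusA) →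
    ∃ u : ℤ_[2]ˣ, ∀ n : ℕ, Even n → ∃ q r : IwasawaAlgebra 2,
      PowerSeries.C (((2 : ℤ_[2]) ^ m' : ℤ_[2]) : ℚ_[2]) *
          (PowerSeries.C ((2 : ℚ_[2]) ^ m * (ϖ : ℚ_[2])) *
            ((mazurTateElement f 2 n).map (algebraMap ℚ ℚ_[2]) : PowerSeries ℚ_[2]) *
            iwasawaToPowerSeries 2 (eulerFactorProduct W 2 S₀)) -
        PowerSeries.C (((u : ℤ_[2]) * (2 : ℤ_[2]) ^ m : ℤ_[2]) : ℚ_[2]) *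
          (PowerSeries.C ((2 : ℚ_[2]) ^ m' * (ϖA : ℚ_[2])) *
            ((mazurTateElement fA 2 n).map (algebraMap ℚ ℚ_[2]) : PowerSeries ℚ_[2]) *
            iwasawaToPowerSeries 2 (eulerFactorProduct A 2 S₀)) =
      iwasawaToPowerSeries 2
        (PowerSeries.C ((2 : ℤ_[2]) ^ (m + m' + 1)) * q + toIwasawa 2 (cyclotomicOmega 2 n) * r)) :
    Summit.BirchSwinnertonDyer.BirchSwinnertonDyer.Theses.ThetaPartnerAtTwo.SignedTransportAtTwo :=
  signedTransportAtTwo_of_gvBinders_congruence hmuT hlam2 (v2cong_of_v2mt hV2mt)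

end Summit.BirchSwinnertonDyer.BirchSwinnertonDyer.Theorems.SignedTransportAtTwo

end
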